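import Summits.CriticalPhenomena.SAWScalingLimit.Theorems.SAWReversalUpgradeAttachmentExistsAnchors

/-!
# Assembly of the standard attachment: the prescribed range is a simple arc from `a` to `b`
# (route `SAWReversalUpgrade`, helper for item `AttachmentExists`, stmt-CriticalPhenomena-18009)

Continuation of `…AttachmentExistsAnchors`: the abstract form `att_core_abstract` of the
per-walk statement of `AttachmentExists`. Given the analytic data (`Φ`, `ψ = Φ⁻¹`, the squeeze
`A`), the polyline data (`P`, tail `τ`) and all the quantities of the route statement as
variables with their defining equations (`R, Z, i, j, p, q, s₁, r₁, u₁, v₁, S`), there is an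
injective curve from `a` to `b` with interior in `D` whose range is `S` when `u₁ < v₁` and the
fallback arc `{a, b} ∪ Φ(iℝ₊)` otherwise. The arc is glued (`arcs_append`) from the access
segment `Φ([0, s₁] p)`, the middle piece `Z([u₁, min v₁ τ]) = Z([u₁, v₁])` and the closed exit
ray `Φ([r₁, ∞] q)` (or the point `b`), which pairwise meet only at the junctions — the access
segment and the exit ray are disjoint because `‖p‖ ≤ ‖ψ (P 0)‖ < ‖ψ (P 1)‖ = ‖q‖`.

Folklore.
-/

noncomputable section

namespace Summit.CriticalPhenomena.SAWScalingLimit.Theorems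

open Set Function Filter Topology
open scoped unitInterval

/-- **The standard attachment exists (abstract form).** See the module docstring. [folklore] -/
theorem att_core_abstract {D : Set ℂ} {a b : ℂ} {Φ A ψ : ℂ → ℂ} {e : ℝ} {P : C(I, ℂ)} {τ : ℝ}
    {R Z : ℝ → ℂ} {i j : ℝ} {p q : ℂ} {s₁ r₁ u₁ v₁ : ℝ} {S : Set ℂ}
    (hR : ∀ u, R u = P (projIcc 0 1 zero_le_one u))
    (hψ : ψ = invFunOn Φ {z : ℂ | 0 ≤ z.im})
    (hA : ∀ z, A z = (‖z‖ : ℂ) * Complex.exp (Complex.I * ((e : ℂ) +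
      (1 - 2 * (e : ℂ) / (Real.pi : ℂ)) * (Complex.arg z : ℂ))))
    (hZ : ∀ u, Z u = @ite ℂ (R u = b) (Classical.propDecidable _) b (Φ (A (ψ (R u)))))
    (hi : i = sSup ({(0 : ℝ)} ∪ {u | u ∈ Icc (0 : ℝ) 1 ∧ R u = a}))
    (hj : j = sInf ({(1 : ℝ)} ∪ {u | u ∈ Icc (0 : ℝ) 1 ∧ R u = b}))
    (hp : p = A (ψ (R i))) (hq : q = A (ψ (R j)))
    (hs : s₁ = sInf {s | s ∈ Ioc (0 : ℝ) 1 ∧ Φ ((s : ℂ) * p) ∈ Z '' Icc i j})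
    (hr : r₁ = sSup ({(1 : ℝ)} ∪ {r | 1 ≤ r ∧ R j ≠ b ∧ Φ ((r : ℂ) * q) ∈ Z '' Icc i j}))
    (hu : u₁ = sInf {u | u ∈ Icc i j ∧ Z u = Φ ((s₁ : ℂ) * p)})
    (hv : v₁ = sSup ({u | u ∈ Icc i j ∧ R j = b ∧ u = j} ∪
      {u | u ∈ Icc i j ∧ R j ≠ b ∧ Z u = Φ ((r₁ : ℂ) * q)}))
    (hS : S = ((({a, b} ∪ ((fun s : ℝ => Φ ((s : ℂ) * p)) '' Ioc 0 s₁)) ∪ (Z '' Icc u₁ v₁)) ∪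
      ((fun r : ℝ => Φ ((r : ℂ) * q)) '' {r | r₁ ≤ r ∧ R j ≠ b})))
    (hab : a ≠ b) (haD : a ∉ D) (hbD : b ∉ D)
    (hΦc : ContinuousOn Φ {z : ℂ | 0 ≤ z.im}) (hΦi : InjOn Φ {z : ℂ | 0 ≤ z.im})
    (hΦ0 : Φ 0 = a) (hΦD : ∀ z : ℂ, 0 < z.im → Φ z ∈ D) (hΦb : ∀ z : ℂ, 0 ≤ z.im → Φ z ≠ b)
    (hΦinf : Tendsto Φ (cocompact ℂ ⊓ 𝓟 {z : ℂ | 0 ≤ z.im}) (𝓝 b))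
    (hsurj : closure D \ {b} ⊆ Φ '' {z : ℂ | 0 ≤ z.im})
    (hψc : ContinuousOn ψ (closure D \ {b})) (he0 : 0 < e) (he1 : e ≤ 1 / 2)
    (hP0 : P 0 ∈ D) (hP1 : P 1 ∈ D) (hPcl : ∀ t, P t ∈ closure D) (hτ0 : 0 ≤ τ)
    (hPtail : ∀ t : I, τ ≤ (t : ℝ) → P t = P 1)
    (hPinj : ∀ s t : I, s < t → P s = P t → τ ≤ (s : ℝ)) (hnorm : ‖ψ (P 0)‖ < ‖ψ (P 1)‖) :
    ∃ c : Literature.Probability.RandomPlanarGeometry.Curve ℂ, Injective c ∧ c.source = a ∧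
      c.target = b ∧ (∀ t, c t = a ∨ c t = b ∨ c t ∈ D) ∧ (u₁ < v₁ → range c = S) ∧
      (¬ u₁ < v₁ → range c = {a, b} ∪ ((fun y : ℝ => Φ (Complex.I * (y : ℂ))) '' Ioi 0)) := by
  obtain ⟨cF, hcFi, hcFs, hcFt, hcFD, hcFr⟩ := fallback_curve hab hΦc hΦi hΦ0 hΦD hΦb hΦinf
  by_cases hlt : u₁ < v₁
  swap
  · exact ⟨cF, hcFi, hcFs, hcFt, hcFD, fun h => absurd h hlt, fun _ => hcFr⟩
  have hRcl : ∀ u, R u ∈ closure D := trim_R_mem hR hPcl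
  -- `i ≤ j`, for otherwise `u₁ = v₁ = 0`
  have hij : i ≤ j := by
    by_contra h
    have hempty : Icc i j = ∅ := Icc_eq_empty h
    have hu0 : u₁ = 0 := by
      rw [hu, hempty]; simp only [mem_empty_iff_false, false_and, setOf_false, Real.sInf_empty]
    have hv0 : v₁ = 0 := by
      rw [hv, hempty]
      simp only [mem_empty_iff_false, false_and, setOf_false, union_self, Real.sSup_empty]
    rw [hu0, hv0] at hlt
    exact lt_irrefl _ hlt
  -- the anchors
  obtain ⟨hpim, hpnorm, hp0, hppos, hZi⟩ :=
    anc_p_spec hR hZ hi hψ hΦi hsurj hΦ0 hab hbD hPcl hP0 he0 he1 hA hp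
  obtain ⟨hs0, hs1, hsM, hsmin, hpor, hps⟩ := anc_s_spec hR hZ hi hj hψ hΦc hΦi hΦb hΦinf hsurj
    hΦ0 hψc hab hbD hPcl hP0 he0 he1 hA hij hp hs
  obtain ⟨humem, hZu, humin, huτ⟩ := anc_u_spec hR hZ hi hj hψ hΦc hΦb hΦinf hsurj hψc hbD haD
    hPcl hP0 hP1 he0 he1 hA hτ0 hPtail hsM hu
  obtain ⟨hr1, hrb, hrspec⟩ := anc_r_spec hR hZ hi hj hψ hΦc hΦi hΦb hΦinf hsurj hΦ0 hψc haD
    hbD hPcl hP0 hP1 he0 he1 hA hij hq hr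
  obtain ⟨hvmem, hvb, hvspec⟩ := anc_v_spec hR hZ hi hj hψ hΦc hΦb hΦinf hsurj hψc hbD hPcl hP0
    he0 he1 hA hij (fun h => (hrspec h).1) hv
  obtain ⟨huv', hmid, hZv'⟩ := anc_middle_eq hR hZ hτ0 hPtail huτ hlt.le
  have hZc := sqd_Z_continuousOn hR hZ hi hj hψ hΦc hΦb hΦinf hsurj hψc hRcl hbD hP0 he0 he1 hA
  have hZinj := sqd_Z_injOn hR hZ hi hj hψ hΦi hsurj hRcl he0 he1 hA hΦb hPinj
  have hZa := sqd_Z_eq_a_iff hZ hψ hΦi hsurj hΦ0 hRcl he0 he1 hA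
  have hsub1 : Icc u₁ (min v₁ τ) ⊆ Icc i j := fun u hu' =>
    ⟨humem.1.trans hu'.1, (hu'.2.trans (min_le_left _ _)).trans hvmem.2⟩
  have hsub2 : Icc u₁ (min v₁ τ) ⊆ Icc i (min j τ) := fun u hu' =>
    ⟨humem.1.trans hu'.1, hu'.2.trans (min_le_min hvmem.2 le_rfl)⟩
  -- value of `Z v₁` when the polyline visits `b`
  have hZvb : R j = b → Z v₁ = b := fun h => by rw [hvb h]; exact sqd_Z_of_eq hZ h
  -- the three weak arcs
  have hg0 : Φ (((0 : ℝ) : ℂ) * p) = a := by rw [Complex.ofReal_zero, zero_mul, hΦ0]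
  have hW1 := arcs_segment hΦc hΦi hpim hs0 hpor
  rw [hg0, ← hZu] at hW1
  have hW2 := arcs_of_continuousOn_injOn huv' (hZc.mono hsub1) (hZinj.mono hsub2)
  rw [hZv'] at hW2
  have hW3 : (Z v₁ = b ∧ ((fun r : ℝ => Φ ((r : ℂ) * q)) '' {r | r₁ ≤ r ∧ R j ≠ b} ∪ {b}) =
      {Z v₁}) ∨ ∃ γ : Path (Z v₁) b, Injective γ ∧
        range γ = (fun r : ℝ => Φ ((r : ℂ) * q)) '' {r | r₁ ≤ r ∧ R j ≠ b} ∪ {b} := by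
    by_cases hRj : R j = b
    · left
      refine ⟨hZvb hRj, ?_⟩
      rw [hZvb hRj]
      have : {r : ℝ | r₁ ≤ r ∧ R j ≠ b} = ∅ := by ext r; simp [hRj]
      rw [this, image_empty, empty_union]
    · right
      obtain ⟨hqim, -, -⟩ := anc_q_spec hR hZ hj hψ hΦi hsurj hΦ0 haD hPcl hP1 he0 he1 hA hq hRj
      have hq0 : q ≠ 0 := fun h => by rw [h] at hqim; simp at hqim
      obtain ⟨γ, hγ, hγr⟩ := arcs_ray hΦc hΦi hΦb hΦinf hqim.le hq0 (zero_lt_one.trans_le hr1)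
      have hset : {r : ℝ | r₁ ≤ r ∧ R j ≠ b} = Ici r₁ := by ext r; simp [hRj]
      rw [hset, (hvspec hRj).1]
      exact ⟨γ, hγ, hγr⟩
  -- junction 1: access segment ∩ middle piece ⊆ {Z u₁}
  have hI1 : (fun s : ℝ => Φ ((s : ℂ) * p)) '' Icc 0 s₁ ∩ Z '' Icc u₁ (min v₁ τ) ⊆ {Z u₁} := by
    rintro x ⟨hx₁, hx⟩
    simp only [mem_image] at hx₁
    obtain ⟨s, hs', rfl⟩ := hx₁
    rw [mem_singleton_iff]
    rcases hs'.2.lt_or_eq with hlt' | rfl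
    · rcases hs'.1.eq_or_lt with rfl | hpos
      · -- the point `a` on the middle piece: then `u₁ = i`
        rw [hg0] at hx ⊢
        obtain ⟨u, hu', hua⟩ := hx
        have hRu : R u = a := (hZa u).1 hua
        have hui : u = i := trim_eq_i_of_R_eq_a hR hi hj (hsub1 hu') hRu
        have hle : u₁ ≤ i := hui ▸ hu'.1
        have hui' : u₁ = i := le_antisymm hle humem.1
        rw [hui', ← hui, hua]
      · exact absurd (image_mono hsub1 hx) (hsmin s hpos hlt')
    · exact hZu.symm
  -- junction 2: (access segment ∪ middle piece) ∩ closed exit ray ⊆ {Z v₁}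
  have hI2 : ((fun s : ℝ => Φ ((s : ℂ) * p)) '' Icc 0 s₁ ∪ Z '' Icc u₁ (min v₁ τ)) ∩
      ((fun r : ℝ => Φ ((r : ℂ) * q)) '' {r | r₁ ≤ r ∧ R j ≠ b} ∪ {b}) ⊆ {Z v₁} := by
    rintro x ⟨hx, hx'⟩
    rw [mem_singleton_iff]
    simp only [mem_union, mem_image, mem_singleton_iff, mem_setOf_eq] at hx hx'
    rcases hx' with ⟨r, ⟨hr', hRj⟩, rfl⟩ | hxb
    · rcases hr'.eq_or_lt with heq | hgt
      · rw [← heq]; exact (hvspec hRj).1.symm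
      · -- beyond `r₁`: off `M`, and off the access segment by the norm separation
        have hnotM : Φ ((r : ℂ) * q) ∉ Z '' Icc i j := (hrspec hRj).2 r hgt
        rcases hx with ⟨s, hs', hsx⟩ | ⟨u, hu', hux⟩
        · exfalso
          obtain ⟨hqim, hqnorm, -⟩ :=
            anc_q_spec hR hZ hj hψ hΦi hsurj hΦ0 haD hPcl hP1 he0 he1 hA hq hRj
          have hr0 : (0 : ℝ) ≤ r := zero_le_one.trans (hr1.trans hgt.le)
          have h1 := hΦi (ray_im_nonneg hpim hs'.1) (ray_im_nonneg hqim.le hr0) hsx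
          have h2 : s * ‖p‖ = r * ‖q‖ := by
            have h := congrArg norm h1
            rwa [norm_mul, norm_mul, Complex.norm_real, Complex.norm_real, Real.norm_eq_abs,
              Real.norm_eq_abs, abs_of_nonneg hs'.1, abs_of_nonneg hr0] at h
          have hple : ‖p‖ ≤ ‖ψ (P 0)‖ := by
            rcases trim_R_i hR hi with h | ⟨-, h⟩
            · rw [hp0.2 h, norm_zero]; exact norm_nonneg _
            · rw [hpnorm, h]
          have h3 : s * ‖p‖ ≤ 1 * ‖ψ (P 0)‖ :=
            mul_le_mul (hs'.2.trans hs1) hple (norm_nonneg _) zero_le_one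
          have h4 : 1 * ‖q‖ ≤ r * ‖q‖ :=
            mul_le_mul_of_nonneg_right (hr1.trans hgt.le) (norm_nonneg _)
          rw [← hqnorm] at hnorm
          linarith
        · exact absurd (image_mono hsub1 ⟨u, hu', hux⟩) hnotM
    · rw [hxb] at hx ⊢
      by_cases hRj : R j = b
      · exact (hZvb hRj).symm
      · exfalso
        rcases hx with ⟨s, hs', hsx⟩ | ⟨u, hu', hux⟩
        · exact hΦb _ (ray_im_nonneg hpim hs'.1) hsx
        · exact sqd_b_not_mem_M hR hZ hi hj hψ hsurj hRcl he0 he1 hA hΦb hRj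
            (image_mono hsub1 ⟨u, hu', hux⟩)
  -- glue the three pieces and pass to a curve
  have hW := arcs_append (arcs_append hW1 hW2 hI1) hW3 hI2
  obtain ⟨c, hci, hcs, hct, hcr⟩ := arcs_exists_curve hab hW
  -- identify the trace with `S`
  have hAcc : (fun s : ℝ => Φ ((s : ℂ) * p)) '' Icc 0 s₁ =
      insert a ((fun s : ℝ => Φ ((s : ℂ) * p)) '' Ioc 0 s₁) := by
    rw [← Ioc_insert_left hs0, image_insert_eq]
    simp only [hg0]
  have htrace : ((fun s : ℝ => Φ ((s : ℂ) * p)) '' Icc 0 s₁ ∪ Z '' Icc u₁ (min v₁ τ)) ∪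
      ((fun r : ℝ => Φ ((r : ℂ) * q)) '' {r | r₁ ≤ r ∧ R j ≠ b} ∪ {b}) = S := by
    rw [hS, hAcc, ← hmid]
    ext x
    simp only [mem_union, mem_insert_iff, mem_singleton_iff]
    constructor
    · rintro (((h | h) | h) | (h | h))
      · exact Or.inl (Or.inl (Or.inl (Or.inl h)))
      · exact Or.inl (Or.inl (Or.inr h))
      · exact Or.inl (Or.inr h)
      · exact Or.inr h
      · exact Or.inl (Or.inl (Or.inl (Or.inr h)))
    · rintro ((((h | h) | h) | h) | h)
      · exact Or.inl (Or.inl (Or.inl h))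
      · exact Or.inr (Or.inr h)
      · exact Or.inl (Or.inl (Or.inr h))
      · exact Or.inl (Or.inr h)
      · exact Or.inr (Or.inl h)
  refine ⟨c, hci, hcs, hct, fun t => ?_, fun _ => by rw [hcr, htrace], fun h => absurd hlt h⟩
  -- the interior of the arc lies in `D`
  have ht : c t ∈ range c := ⟨t, rfl⟩
  rw [hcr] at ht
  simp only [mem_union, mem_image, mem_singleton_iff, mem_setOf_eq] at ht
  rcases ht with (⟨s, hs', hsx⟩ | ⟨u, -, hux⟩) | (⟨r, ⟨hr', hRj⟩, hrx⟩ | hb)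
  · rcases hs'.1.eq_or_lt with h0 | hpos
    · left; rw [← hsx, ← h0, hg0]
    · right; right; rw [← hsx]
      have hpne : p ≠ 0 := by
        rcases hpor with h | h
        · exact h
        · exfalso; rw [h] at hs'; linarith [hs'.2]
      exact hΦD _ (ray_im_pos (hppos fun h => hpne (hp0.2 h)) hpos)
  · rw [← hux]; exact sqd_Z_mem hZ hψ hΦi hsurj hΦ0 hΦD hRcl he0 he1 hA u
  · right; right; rw [← hrx]
    obtain ⟨hqim, -, -⟩ := anc_q_spec hR hZ hj hψ hΦi hsurj hΦ0 haD hPcl hP1 he0 he1 hA hq hRj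
    exact hΦD _ (ray_im_pos hqim (zero_lt_one.trans_le (hr1.trans hr')))
  · exact Or.inr (Or.inl hb)

/-- **The standard attachment exists (route form, one walk).** The conclusion is literally the
`let`-block of the route statement `AttachmentExists` for one mesh `δ` and one polyline `P`,
with the domain data abstracted (`Dset = D.carrier`, `a = D.pt 0`, `b = D.pt 1`,
`Φ = φ.boundaryExtension`); the hypotheses are discharged in the closing file from
Carathéodory's theorem and the geometry of SAW polylines. [folklore] -/
theorem att_core {Dset : Set ℂ} {a b : ℂ} {Φ : ℂ → ℂ} {P : C(unitInterval, ℂ)} {δ τ : ℝ}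
    (hδ : 0 < δ) (hab : a ≠ b) (haD : a ∉ Dset) (hbD : b ∉ Dset)
    (hΦc : ContinuousOn Φ {z : ℂ | 0 ≤ z.im}) (hΦi : InjOn Φ {z : ℂ | 0 ≤ z.im})
    (hΦ0 : Φ 0 = a) (hΦD : ∀ z : ℂ, 0 < z.im → Φ z ∈ Dset) (hΦb : ∀ z : ℂ, 0 ≤ z.im → Φ z ≠ b)
    (hΦinf : Tendsto Φ (cocompact ℂ ⊓ 𝓟 {z : ℂ | 0 ≤ z.im}) (𝓝 b))
    (hsurj : closure Dset \ {b} ⊆ Φ '' {z : ℂ | 0 ≤ z.im})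
    (hψc : ContinuousOn (Function.invFunOn Φ {z : ℂ | 0 ≤ z.im}) (closure Dset \ {b}))
    (hP0 : P 0 ∈ Dset) (hP1 : P 1 ∈ Dset) (hPcl : ∀ t, P t ∈ closure Dset) (hτ0 : 0 ≤ τ)
    (hPtail : ∀ t : I, τ ≤ (t : ℝ) → P t = P 1)
    (hPinj : ∀ s t : I, s < t → P s = P t → τ ≤ (s : ℝ))
    (hnorm : ‖Function.invFunOn Φ {z : ℂ | 0 ≤ z.im} (P 0)‖ <
      ‖Function.invFunOn Φ {z : ℂ | 0 ≤ z.im} (P 1)‖) :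
    (let R₁ := fun u : ℝ => P (Set.projIcc (0:ℝ) 1 zero_le_one u)
    let φ₁ := Φ
    let ψ₁ := Function.invFunOn φ₁ {z : ℂ | 0 ≤ z.im}
    let e₁ : ℝ := min δ (1/2)
    let A₁ := fun z : ℂ => (‖z‖ : ℂ) * Complex.exp (Complex.I * ((e₁ : ℂ) + (1 - 2 * (e₁ : ℂ) / (Real.pi : ℂ)) * (Complex.arg z : ℂ)))
    let Z₁ := fun u : ℝ => @ite ℂ (R₁ u = b) (Classical.propDecidable _) b (φ₁ (A₁ (ψ₁ (R₁ u))))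
    let i₁ := sSup ({(0:ℝ)} ∪ {u | u ∈ Set.Icc (0:ℝ) 1 ∧ R₁ u = a})
    let j₁ := sInf ({(1:ℝ)} ∪ {u | u ∈ Set.Icc (0:ℝ) 1 ∧ R₁ u = b})
    let M₁ := Z₁ '' Set.Icc i₁ j₁
    let p₁ := A₁ (ψ₁ (R₁ i₁))
    let q₁ := A₁ (ψ₁ (R₁ j₁))
    let s₁ := sInf {s | s ∈ Set.Ioc (0:ℝ) 1 ∧ φ₁ ((s : ℂ) * p₁) ∈ M₁}
    let r₁ := sSup ({(1:ℝ)} ∪ {r | 1 ≤ r ∧ R₁ j₁ ≠ b ∧ φ₁ ((r : ℂ) * q₁) ∈ M₁})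
    let u₁ := sInf {u | u ∈ Set.Icc i₁ j₁ ∧ Z₁ u = φ₁ ((s₁ : ℂ) * p₁)}
    let v₁ := sSup ({u | u ∈ Set.Icc i₁ j₁ ∧ R₁ j₁ = b ∧ u = j₁} ∪ {u | u ∈ Set.Icc i₁ j₁ ∧ R₁ j₁ ≠ b ∧ Z₁ u = φ₁ ((r₁ : ℂ) * q₁)})
    let S₁ := ((({a, b} ∪ ((fun s : ℝ => φ₁ ((s : ℂ) * p₁)) '' Set.Ioc 0 s₁)) ∪ (Z₁ '' Set.Icc u₁ v₁)) ∪ ((fun r : ℝ => φ₁ ((r : ℂ) * q₁)) '' {r | r₁ ≤ r ∧ R₁ j₁ ≠ b}))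
    ∃ c : Literature.Probability.RandomPlanarGeometry.Curve ℂ, Function.Injective c ∧ c.source = a ∧ c.target = b ∧ (∀ t : unitInterval, c t = a ∨ c t = b ∨ c t ∈ Dset) ∧ (u₁ < v₁ → Set.range c = S₁) ∧ (¬ u₁ < v₁ → Set.range c = {a, b} ∪ ((fun y : ℝ => φ₁ (Complex.I * (y : ℂ))) '' Set.Ioi 0))) := by
  intro R₁ φ₁ ψ₁ e₁ A₁ Z₁ i₁ j₁ M₁ p₁ q₁ s₁ r₁ u₁ v₁ S₁
  exact att_core_abstract (D := Dset) (Φ := Φ) (R := R₁) (ψ := ψ₁) (A := A₁) (Z := Z₁) (i := i₁)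
    (j := j₁) (p := p₁) (q := q₁) (s₁ := s₁) (r₁ := r₁) (u₁ := u₁) (v₁ := v₁) (S := S₁) (e := e₁)
    (fun _ => rfl) rfl (fun _ => rfl) (fun _ => rfl) rfl rfl rfl rfl rfl rfl rfl rfl rfl
    hab haD hbD hΦc hΦi hΦ0 hΦD hΦb hΦinf hsurj hψc (lt_min hδ one_half_pos) (min_le_right _ _)
    hP0 hP1 hPcl hτ0 hPtail hPinj hnorm

end Summit.CriticalPhenomena.SAWScalingLimit.Theorems
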